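import Mathlib
import Summits.Ventures.PercRepro2.SepTwoGcZero
import Summits.Ventures.PercRepro2.MixChordOLeafRootMirror

/-!
# `a₃` SEPARATED FROM `o` AND `b` BY THE ROOTS: `Gc` is the `(D, T, T′)`-mixture of the three `a₃`-free
chord functionals, and the `o`-class `D`-chord holds (blind cell PercRepro2, night-1 g23;
proofs/NIGHT1-G23.md §7)

Let `K = C_{G − {a₁, a₂}}(a₃)` be the component of `a₃` in the graph with the roots removed
(`SepPair.sepConfig`), and suppose `o ∉ K`, `b ∉ K` — every path from `a₃` to `o` or to `b` passes through
a root.  Typer-1 g49's cleared product law across a separating pair (`SepTwoGcZero.prob_inter_mul_of_detOn`,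
with `K` the block of `a₃`: `PD`, `T`, `T′` are determined by the edges touching `K`, the events of `o`, `b`
by the other edges) collapses every mass of `Gc` that mixes `a₃` with `o` or `b`, and the thirty masses
reassemble into the EXACT identity

  **`Z_mul_Gc`**: `Z · Gc = D · (D · I + T · J + T′ · J′)`,

`I = −2C(oH,bL) − 2C(oL,bH)`, `J = 2C(oL,bL) − 2C(oL,bH)`, `J′ = 2C(oH,bH) − 2C(oH,bL)` the three `a₃`-free
functionals of MixChordOChords.lean (`C` = `PendantRoot.covC`), `T = P(Q, a₃ ∈ C₂)`, `T′ = P(Q, a₃ ∈ C₁)`.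
Since `D/Z`, `T/Z`, `T′/Z` do not see an edge of the `(o, b)`-side (**`D_mul_Z_update`** and its `T`, `T′`
forms: `D · Z⁰ = D⁰ · Z` along the `o`-edge), the `D`-chord along `f = {o, a₁}` is the `(D, T, T′)`-mixture of
the `I`-, `J`-, `J′`-chords (`iChord`, `jChord`, `j'Chord`): **`dChord_o_edge_of_separated`**, the mirror
**`dChord_o_edge₂_of_separated`** (along `{o, a₂}`), and the chain's rows `dz2Chord_o_edge_of_separated` /
`_o_edge₂_`.  This class contains every class of the `o`-row proved so far (a leaf at a root, alone behind
a cut vertex at a root, the two-root star, the pendant block plus one edge) and needs no induction.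
Also **`HCov_of_separated`**: `0 ≤ Gc` on the class (`I, J, J′ ≥ 0`).

Own code; standard axioms.
-/

namespace Summit.Ventures.PercRepro2

open UnionCluster CovForm SepTwoGcZero SepPair SepZero

namespace Mix

namespace Sep

open scoped Classical

section Masses

variable {V : Type*} {E : Type*} [Fintype E] [DecidableEq E] [Fintype V] [DecidableEq V] {R : Type*} [Field R]

variable (p : E → R) (ends : E → Sym2 V) (o a₁ a₂ a₃ b : V)

/-- The component of `a₃` in `G − {a₁, a₂}`. -/
noncomputable abbrev blk : Set V := cluster ends (sepConfig ends {a₁, a₂}) a₃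

variable {ends a₁ a₂ a₃}

/-- **The split of a mass across the pair**: for `S ⊆ Q` determined by the edges touching the block of
`a₃` and `X` determined by the other edges, `P(S ∩ X) · Z = P(S) · P(Q ∩ X)`. -/
lemma split (h3 : a₃ ∉ ({a₁, a₂} : Set V)) {S X : Set (Config E)} (hSQ : S ⊆ avoidAll ends a₂ {a₁})
    (hS : DetOn ends a₁ a₂ (touches ends (blk ends a₁ a₂ a₃)) S)
    (hX : DetOn ends a₁ a₂ (touches ends (blk ends a₁ a₂ a₃))ᶜ X) :
    prob p (S ∩ X) * prob p (avoidAll ends a₂ {a₁}) = prob p S * prob p (avoidAll ends a₂ {a₁} ∩ X) := by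
  have h := prob_inter_mul_of_detOn p h3 hSQ Set.inter_subset_left hS (detOn_Q.inter hX)
  have hset : S ∩ (avoidAll ends a₂ {a₁} ∩ X) = S ∩ X := by
    ext ω
    exact ⟨fun ⟨h1, _, h2⟩ => ⟨h1, h2⟩, fun ⟨h1, h2⟩ => ⟨h1, hSQ h1, h2⟩⟩
  rwa [hset] at h

omit [Fintype E] [DecidableEq E] [Fintype V] [DecidableEq V] in
/-- `a₃` lies in its own block. -/
lemma a3_mem_blk : a₃ ∈ blk ends a₁ a₂ a₃ := mem_cluster_self _ _ _

omit [Fintype E] [DecidableEq E] in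
/-- A connection between a root and a vertex outside the block is determined by the other edges. -/
lemma detOn_conn_out (h3 : a₃ ∉ ({a₁, a₂} : Set V)) {v : V} (hv : v ∉ blk ends a₁ a₂ a₃) {i : V}
    (hi : i = a₁ ∨ i = a₂) :
    DetOn ends a₁ a₂ (touches ends (blk ends a₁ a₂ a₃))ᶜ (connEvent ends i v) :=
  detOn_connEvent_of_not_mem h3 hv hi

/-- **`Z · Gc = D · (D · I + T · J + T′ · J′)`** when `a₃` is separated from `o` and `b` by the roots. -/
theorem Z_mul_Gc (h3 : a₃ ∉ ({a₁, a₂} : Set V)) (ho : o ∉ blk ends a₁ a₂ a₃)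
    (hb : b ∉ blk ends a₁ a₂ a₃) :
    prob p (avoidAll ends a₂ {a₁}) * Gc p ends o a₁ a₂ a₃ b =
      prob p (PDEvent ends a₁ a₂ a₃) *
        (prob p (PDEvent ends a₁ a₂ a₃) *
            (-2 * PendantRoot.covC p ends a₁ a₂ (connEvent ends a₂ o) (connEvent ends a₁ b) -
              2 * PendantRoot.covC p ends a₁ a₂ (connEvent ends a₁ o) (connEvent ends a₂ b)) +
          prob p (TEvent ends a₁ a₂ a₃) *
            (2 * PendantRoot.covC p ends a₁ a₂ (connEvent ends a₁ o) (connEvent ends a₁ b) -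
              2 * PendantRoot.covC p ends a₁ a₂ (connEvent ends a₁ o) (connEvent ends a₂ b)) +
          prob p (TEvent ends a₂ a₁ a₃) *
            (2 * PendantRoot.covC p ends a₁ a₂ (connEvent ends a₂ o) (connEvent ends a₂ b) -
              2 * PendantRoot.covC p ends a₁ a₂ (connEvent ends a₂ o) (connEvent ends a₁ b))) := by
  -- the block-side events
  have hPD : DetOn ends a₁ a₂ (touches ends (blk ends a₁ a₂ a₃)) (PDEvent ends a₁ a₂ a₃) :=
    detOn_PD_of_mem h3 (a3_mem_blk)
  have hT : DetOn ends a₁ a₂ (touches ends (blk ends a₁ a₂ a₃)) (TEvent ends a₁ a₂ a₃) :=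
    detOn_T_of_mem h3 (a3_mem_blk)
  have hT' : DetOn ends a₁ a₂ (touches ends (blk ends a₁ a₂ a₃)) (TEvent ends a₂ a₁ a₃) :=
    detOn_T'_of_mem h3 (a3_mem_blk)
  have hPDQ : PDEvent ends a₁ a₂ a₃ ⊆ avoidAll ends a₂ {a₁} := PD_subset_Q
  have hTQ : TEvent ends a₁ a₂ a₃ ⊆ avoidAll ends a₂ {a₁} := T_subset_Q
  have hT'Q : TEvent ends a₂ a₁ a₃ ⊆ avoidAll ends a₂ {a₁} := T'_subset_Q
  -- the `(o, b)`-side events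
  have o1 := detOn_conn_out h3 ho (Or.inl rfl : a₁ = a₁ ∨ a₁ = a₂)
  have o2 := detOn_conn_out h3 ho (Or.inr rfl : a₂ = a₁ ∨ a₂ = a₂)
  have b1 := detOn_conn_out h3 hb (Or.inl rfl : a₁ = a₁ ∨ a₁ = a₂)
  have b2 := detOn_conn_out h3 hb (Or.inr rfl : a₂ = a₁ ∨ a₂ = a₂)
  -- the twenty-four splits
  have s1 := split p h3 hPDQ hPD o1
  have s2 := split p h3 hPDQ hPD o2
  have s3 := split p h3 hT'Q hT' b1
  have s4 := split p h3 hTQ hT b2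
  have s5 := split p h3 hTQ hT b1
  have s6 := split p h3 hT'Q hT' b2
  have s7 := split p h3 hT'Q hT' (o1.inter b1)
  have s8 := split p h3 hT'Q hT' (o2.inter b1)
  have s9 := split p h3 hTQ hT (o1.inter b2)
  have s10 := split p h3 hTQ hT (o2.inter b2)
  have s11 := split p h3 hTQ hT (o1.inter b1)
  have s12 := split p h3 hTQ hT (o2.inter b1)
  have s13 := split p h3 hT'Q hT' (o1.inter b2)
  have s14 := split p h3 hT'Q hT' (o2.inter b2)
  have s15 := split p h3 hT'Q hT' o1
  have s16 := split p h3 hT'Q hT' o2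
  have s17 := split p h3 hTQ hT o1
  have s18 := split p h3 hTQ hT o2
  have s19 := split p h3 hPDQ hPD b1
  have s20 := split p h3 hPDQ hPD b2
  have s21 := split p h3 hPDQ hPD (o1.inter b1)
  have s22 := split p h3 hPDQ hPD (o2.inter b1)
  have s23 := split p h3 hPDQ hPD (o1.inter b2)
  have s24 := split p h3 hPDQ hPD (o2.inter b2)
  -- `Z = D + T + T′` and `gap = P(Q, bH) − P(Q, bL)`
  have hZ := Qsplit_univ p ends a₁ a₂ a₃
  have hgap : gap p ends a₁ a₂ b =
      prob p (avoidAll ends a₂ {a₁} ∩ connEvent ends a₂ b) -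
        prob p (avoidAll ends a₂ {a₁} ∩ connEvent ends a₁ b) := by
    unfold gap
    rw [← prob_inter_add_prob_inter_compl p (connEvent ends a₂ b) (avoidAll ends a₂ {a₁}),
      ← prob_inter_add_prob_inter_compl p (connEvent ends a₁ b) (avoidAll ends a₂ {a₁})]
    have hc : connEvent ends a₂ b ∩ (avoidAll ends a₂ {a₁})ᶜ = connEvent ends a₁ b ∩ (avoidAll ends a₂ {a₁})ᶜ := by
      ext ω
      simp only [Set.mem_inter_iff, mem_connEvent, Set.mem_compl_iff, mem_Q, not_not]
      constructor
      · rintro ⟨h1, h2⟩; exact ⟨conn_trans h2 h1, h2⟩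
      · rintro ⟨h1, h2⟩; exact ⟨conn_trans (conn_symm h2) h1, h2⟩
    rw [hc, Set.inter_comm (connEvent ends a₂ b) (avoidAll ends a₂ {a₁}),
      Set.inter_comm (connEvent ends a₁ b) (avoidAll ends a₂ {a₁})]
    ring
  simp only [Gc, EQbo, EQb3, EQb3o, EQo, EQ3, EQ3o, PDb, PDbo, Do, DEF, PendantRoot.covC]
  rw [hgap]
  linear_combination (prob p (avoidAll ends a₂ {a₁}) * (prob p (TEvent ends a₂ a₁ a₃ ∩ connEvent ends a₁ b) + prob p (TEvent ends a₁ a₂ a₃ ∩ connEvent ends a₂ b) - prob p (TEvent ends a₁ a₂ a₃ ∩ connEvent ends a₁ b) - prob p (TEvent ends a₂ a₁ a₃ ∩ connEvent ends a₂ b)) + (prob p (avoidAll ends a₂ {a₁} ∩ connEvent ends a₂ b) - prob p (avoidAll ends a₂ {a₁} ∩ connEvent ends a₁ b)) * (prob p (TEvent ends a₂ a₁ a₃) - prob p (TEvent ends a₁ a₂ a₃)) + prob p (avoidAll ends a₂ {a₁}) * (prob p (PDEvent ends a₁ a₂ a₃ ∩ connEvent ends a₁ b) + prob p (PDEvent ends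 a₁ a₂ a₃ ∩ connEvent ends a₂ b))) * (s1 + s2) + (prob p (PDEvent ends a₁ a₂ a₃) * (prob p (avoidAll ends a₂ {a₁} ∩ connEvent ends a₁ o) + prob p (avoidAll ends a₂ {a₁} ∩ connEvent ends a₂ o))) * (s3 + s4 - s5 - s6) - (prob p (avoidAll ends a₂ {a₁}) * prob p (PDEvent ends a₁ a₂ a₃)) * (s7 + s8 + s9 + s10 - s11 - s12 - s13 - s14) - ((prob p (avoidAll ends a₂ {a₁} ∩ connEvent ends a₂ b) - prob p (avoidAll ends a₂ {a₁} ∩ connEvent ends a₁ b)) * prob p (PDEvent ends a₁ a₂ a₃)) * (s15 + s16 - s17 - s18) + (prob p (PDEvent ends a₁ a₂ a₃) * (prob p (avoidAll ends a₂ {a₁} ∩ connEvent ends a₁ o) + prob p (avoidAll ends a₂ {a₁} ∩ connEvent ends a₂ o))) * (s19 + s20) - (prob p (avoidAll ends a₂ {a₁}) * prob p (PDEvent ends a₁ a₂ a₃)) * (s21 + s22 + s23 + s24) + (prob p (PDEvent ends a₁ a₂ a₃) * (prob p (avoidAll ends a₂ {a₁} ∩ (connEvent ends a₁ o ∩ connEvent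 ends a₁ b)) + prob p (avoidAll ends a₂ {a₁} ∩ (connEvent ends a₂ o ∩ connEvent ends a₂ b)) - prob p (avoidAll ends a₂ {a₁} ∩ (connEvent ends a₂ o ∩ connEvent ends a₁ b)) - prob p (avoidAll ends a₂ {a₁} ∩ (connEvent ends a₁ o ∩ connEvent ends a₂ b))) * prob p (avoidAll ends a₂ {a₁}) - prob p (PDEvent ends a₁ a₂ a₃) * (prob p (avoidAll ends a₂ {a₁} ∩ connEvent ends a₁ b) - prob p (avoidAll ends a₂ {a₁} ∩ connEvent ends a₂ b)) * (prob p (avoidAll ends a₂ {a₁} ∩ connEvent ends a₁ o) - prob p (avoidAll ends a₂ {a₁} ∩ connEvent ends a₂ o))) * hZ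

end Masses

section Chord

variable {V : Type*} {E : Type*} [Fintype E] [DecidableEq E] [Fintype V] [DecidableEq V]
  {R : Type*} [Field R] [LinearOrder R] [IsStrictOrderedRing R]

variable (p : E → R) (ends : E → Sym2 V) {o a₁ a₂ a₃ : V} (b : V) {f : E}

omit [Fintype E] [DecidableEq E] [Fintype V] [DecidableEq V] [Field R] [LinearOrder R] [IsStrictOrderedRing R] in
/-- The roots are not in the block of `a₃`. -/
lemma roots_not_mem_blk (h3 : a₃ ∉ ({a₁, a₂} : Set V)) :
    a₁ ∉ blk ends a₁ a₂ a₃ ∧ a₂ ∉ blk ends a₁ a₂ a₃ := by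
  constructor
  · intro h
    have := not_mem_of_conn_sepConfig h3 (mem_cluster.1 h)
    simp at this
  · intro h
    have := not_mem_of_conn_sepConfig h3 (mem_cluster.1 h)
    simp at this

omit [Fintype E] [DecidableEq E] [Fintype V] [DecidableEq V] [Field R] [LinearOrder R] [IsStrictOrderedRing R] in
/-- The `o`-edge does not touch the block of `a₃`. -/
lemma o_edge_not_mem_touches (h3 : a₃ ∉ ({a₁, a₂} : Set V)) (hf : ends f = s(o, a₁))
    (ho : o ∉ blk ends a₁ a₂ a₃) : f ∉ touches ends (blk ends a₁ a₂ a₃) := by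
  rintro ⟨x, hx, y, hxy⟩
  rw [hf] at hxy
  rcases Sym2.eq_iff.1 hxy with ⟨rfl, -⟩ | ⟨-, rfl⟩
  · exact ho hx
  · exact (roots_not_mem_blk ends h3).1 hx

omit [Fintype E] [DecidableEq E] [Field R] [LinearOrder R] [IsStrictOrderedRing R] in
/-- `{f closed}` is determined by the edges off the block when `f` does not touch it. -/
lemma detOn_closedEdge (hfF : f ∉ touches ends (blk ends a₁ a₂ a₃)) :
    DetOn ends a₁ a₂ (touches ends (blk ends a₁ a₂ a₃))ᶜ (closedEdge f) := fun ω _ => by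
  simp only [mem_closedEdge]
  rw [restrictTo_apply_of_mem (show f ∈ (touches ends (blk ends a₁ a₂ a₃))ᶜ from hfF)]

/-- **The block masses do not see the `o`-edge**: for `S ⊆ Q` determined by the block of `a₃`,
`P(S) · P⁰(Q) = P⁰(S) · P(Q)` (`⁰` = `f` closed), when `p f ≠ 1`. -/
lemma mul_update_zero_eq (h3 : a₃ ∉ ({a₁, a₂} : Set V)) (hfF : f ∉ touches ends (blk ends a₁ a₂ a₃))
    (hq : p f ≠ 1) {S : Set (Config E)} (hSQ : S ⊆ avoidAll ends a₂ {a₁})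
    (hS : DetOn ends a₁ a₂ (touches ends (blk ends a₁ a₂ a₃)) S) :
    prob p S * prob (Function.update p f 0) (avoidAll ends a₂ {a₁}) =
      prob (Function.update p f 0) S * prob p (avoidAll ends a₂ {a₁}) := by
  have h := split p h3 hSQ hS (detOn_closedEdge ends hfF)
  rw [prob_inter_closedEdge, prob_inter_closedEdge] at h
  have h1 : (1 - p f) ≠ 0 := sub_ne_zero.2 (Ne.symm hq)
  have h2 : (1 - p f) * (prob p S * prob (Function.update p f 0) (avoidAll ends a₂ {a₁})) =
      (1 - p f) * (prob (Function.update p f 0) S * prob p (avoidAll ends a₂ {a₁})) := by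
    linear_combination -h
  exact mul_left_cancel₀ h1 h2

/-- **THE `o`-CLASS `D`-CHORD WHEN `a₃` IS SEPARATED FROM `o` AND `b` BY THE ROOTS** (every path from `a₃`
to `o` or to `b` passes through `a₁` or `a₂`), along `f = {o, a₁}`: the `(D, T, T′)`-mixture of the `I`-,
`J`-, `J′`-chords. -/
theorem dChord_o_edge_of_separated (hp : IsProbVec p) (hf : ends f = s(o, a₁))
    (h3 : a₃ ∉ ({a₁, a₂} : Set V)) (ho : o ∉ blk ends a₁ a₂ a₃) (hb : b ∉ blk ends a₁ a₂ a₃) :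
    NMixChord (normD ends a₁ a₂ a₃) p ends o a₁ a₂ a₃ b f := by
  have hG1 : Gc (Function.update p f 1) ends o a₁ a₂ a₃ b = 0 :=
    Gc_eq_zero_of_sure_conn_o _ ends o a₃ b (conn_a1_o_of_update_one p ends hf)
  unfold NMixChord normD
  rw [hG1, mul_zero, sub_zero]
  by_cases hq : p f = 1
  · have hp1 : Function.update p f 1 = p := by rw [← hq, Function.update_eq_self]
    rw [hq, sub_self, zero_mul, zero_mul, ← hp1, hG1, zero_mul]
  have hfF := o_edge_not_mem_touches ends h3 hf ho
  have hp0 : IsProbVec (Function.update p f 0) := hp.update f le_rfl zero_le_one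
  have hid := Z_mul_Gc p o b h3 ho hb
  have hid0 := Z_mul_Gc (Function.update p f 0) o b h3 ho hb
  have kD := mul_update_zero_eq p ends h3 hfF hq PD_subset_Q
    (detOn_PD_of_mem h3 (a3_mem_blk (ends := ends) (a₁ := a₁) (a₂ := a₂) (a₃ := a₃)))
  have kT := mul_update_zero_eq p ends h3 hfF hq T_subset_Q
    (detOn_T_of_mem h3 (a3_mem_blk (ends := ends) (a₁ := a₁) (a₂ := a₂) (a₃ := a₃)))
  have kT' := mul_update_zero_eq p ends h3 hfF hq T'_subset_Q
    (detOn_T'_of_mem h3 (a3_mem_blk (ends := ends) (a₁ := a₁) (a₂ := a₂) (a₃ := a₃)))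
  have hI := iChord p ends (a₂ := a₂) b hp hf
  have hJ := jChord p ends (a₂ := a₂) b hp hf
  have hJ' := j'Chord p ends (a₂ := a₂) b hp hf
  have hZn := prob_nonneg hp (avoidAll ends a₂ {a₁})
  have hZ0n := prob_nonneg hp0 (avoidAll ends a₂ {a₁})
  have hDn := prob_nonneg hp (PDEvent ends a₁ a₂ a₃)
  have hD0n := prob_nonneg hp0 (PDEvent ends a₁ a₂ a₃)
  have hTn := prob_nonneg hp (TEvent ends a₁ a₂ a₃)
  have hT'n := prob_nonneg hp (TEvent ends a₂ a₁ a₃)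
  by_cases hZ : prob p (avoidAll ends a₂ {a₁}) = 0
  · have hGc : Gc p ends o a₁ a₂ a₃ b = 0 := Gc_eq_zero_of_Q_null hp ends o a₁ a₂ a₃ b hZ
    have hD : prob p (PDEvent ends a₁ a₂ a₃) = 0 :=
      le_antisymm ((prob_mono hp PD_subset_Q).trans hZ.le) hDn
    rw [hGc, hD]
    simp
  have hZpos : 0 < prob p (avoidAll ends a₂ {a₁}) := lt_of_le_of_ne hZn (Ne.symm hZ)
  have hZ0pos : 0 < prob (Function.update p f 0) (avoidAll ends a₂ {a₁}) :=
    lt_of_lt_of_le hZpos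
      (EdmRow.prob_le_prob_update_zero_of_isLowerSet hp (EdmRow.isLowerSet_avoidAll ends a₁ a₂) f)
  have key : prob p (avoidAll ends a₂ {a₁}) * prob (Function.update p f 0) (avoidAll ends a₂ {a₁}) * (Gc p ends o a₁ a₂ a₃ b * prob (Function.update p f 0) (PDEvent ends a₁ a₂ a₃) - (1 - p f) * Gc (Function.update p f 0) ends o a₁ a₂ a₃ b * prob p (PDEvent ends a₁ a₂ a₃)) =
      prob p (PDEvent ends a₁ a₂ a₃) * prob (Function.update p f 0) (PDEvent ends a₁ a₂ a₃) * ((prob p (PDEvent ends a₁ a₂ a₃) * prob (Function.update p f 0) (avoidAll ends a₂ {a₁})) * ((-2 * PendantRoot.covC p ends a₁ a₂ (connEvent ends a₂ o) (connEvent ends a₁ b) - 2 * PendantRoot.covC p ends a₁ a₂ (connEvent ends a₁ o) (connEvent ends a₂ b)) - (1 - p f) * (-2 * PendantRoot.covC (Function.update p f 0) ends a₁ a₂ (connEvent ends a₂ o) (connEvent ends a₁ b) - 2 * PendantRoot.covC (Function.update p f 0) ends a₁ a₂ (connEvent ends a₁ o) (connEvent ends a₂ b))) + (prob p (TEvent ends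 a₁ a₂ a₃) * prob (Function.update p f 0) (avoidAll ends a₂ {a₁})) * ((2 * PendantRoot.covC p ends a₁ a₂ (connEvent ends a₁ o) (connEvent ends a₁ b) - 2 * PendantRoot.covC p ends a₁ a₂ (connEvent ends a₁ o) (connEvent ends a₂ b)) - (1 - p f) * (2 * PendantRoot.covC (Function.update p f 0) ends a₁ a₂ (connEvent ends a₁ o) (connEvent ends a₁ b) - 2 * PendantRoot.covC (Function.update p f 0) ends a₁ a₂ (connEvent ends a₁ o) (connEvent ends a₂ b))) + (prob p (TEvent ends a₂ a₁ a₃) * prob (Function.update p f 0) (avoidAll ends a₂ {a₁})) * ((2 * PendantRoot.covC p ends a₁ a₂ (connEvent ends a₂ o) (connEvent ends a₂ b) - 2 * PendantRoot.covC p ends a₁ a₂ (connEvent ends a₂ o) (connEvent ends a₁ b)) - (1 - p f) * (2 * PendantRoot.covC (Function.update p f 0) ends a₁ a₂ (connEvent ends a₂ o) (connEvent ends a₂ b) - 2 * PendantRoot.covC (Function.update p f 0) ends a₁ a₂ (connEvent ends a₂ o) (connEvent ends a₁ b)))) := by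
      linear_combination (prob (Function.update p f 0) (avoidAll ends a₂ {a₁}) * prob (Function.update p f 0) (PDEvent ends a₁ a₂ a₃)) * hid - ((1 - p f) * prob p (avoidAll ends a₂ {a₁}) * prob p (PDEvent ends a₁ a₂ a₃)) * hid0 + (prob p (PDEvent ends a₁ a₂ a₃) * prob (Function.update p f 0) (PDEvent ends a₁ a₂ a₃) * (1 - p f) * (-2 * PendantRoot.covC (Function.update p f 0) ends a₁ a₂ (connEvent ends a₂ o) (connEvent ends a₁ b) - 2 * PendantRoot.covC (Function.update p f 0) ends a₁ a₂ (connEvent ends a₁ o) (connEvent ends a₂ b))) * kD + (prob p (PDEvent ends a₁ a₂ a₃) * prob (Function.update p f 0) (PDEvent ends a₁ a₂ a₃) * (1 - p f) * (2 * PendantRoot.covC (Function.update p f 0) ends a₁ a₂ (connEvent ends a₁ o) (connEvent ends a₁ b) - 2 * PendantRoot.covC (Function.update p f 0) ends a₁ a₂ (connEvent ends a₁ o) (connEvent ends a₂ b))) * kT + (prob p (PDEvent ends a₁ a₂ a₃) * prob (Function.update p f 0) (PDEvent ends a₁ a₂ a₃) * (1 - p f) * (2 * PendantRoot.covC (Function.update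 p f 0) ends a₁ a₂ (connEvent ends a₂ o) (connEvent ends a₂ b) - 2 * PendantRoot.covC (Function.update p f 0) ends a₁ a₂ (connEvent ends a₂ o) (connEvent ends a₁ b))) * kT'
  have hrhs : 0 ≤ prob p (PDEvent ends a₁ a₂ a₃) * prob (Function.update p f 0) (PDEvent ends a₁ a₂ a₃) * ((prob p (PDEvent ends a₁ a₂ a₃) * prob (Function.update p f 0) (avoidAll ends a₂ {a₁})) * ((-2 * PendantRoot.covC p ends a₁ a₂ (connEvent ends a₂ o) (connEvent ends a₁ b) - 2 * PendantRoot.covC p ends a₁ a₂ (connEvent ends a₁ o) (connEvent ends a₂ b)) - (1 - p f) * (-2 * PendantRoot.covC (Function.update p f 0) ends a₁ a₂ (connEvent ends a₂ o) (connEvent ends a₁ b) - 2 * PendantRoot.covC (Function.update p f 0) ends a₁ a₂ (connEvent ends a₁ o) (connEvent ends a₂ b))) + (prob p (TEvent ends a₁ a₂ a₃) * prob (Function.update p f 0) (avoidAll ends a₂ {a₁})) * ((2 * PendantRoot.covC p ends a₁ a₂ (connEvent ends a₁ o) (connEvent ends a₁ b) - 2 * PendantRoot.covC p ends a₁ a₂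 (connEvent ends a₁ o) (connEvent ends a₂ b)) - (1 - p f) * (2 * PendantRoot.covC (Function.update p f 0) ends a₁ a₂ (connEvent ends a₁ o) (connEvent ends a₁ b) - 2 * PendantRoot.covC (Function.update p f 0) ends a₁ a₂ (connEvent ends a₁ o) (connEvent ends a₂ b))) + (prob p (TEvent ends a₂ a₁ a₃) * prob (Function.update p f 0) (avoidAll ends a₂ {a₁})) * ((2 * PendantRoot.covC p ends a₁ a₂ (connEvent ends a₂ o) (connEvent ends a₂ b) - 2 * PendantRoot.covC p ends a₁ a₂ (connEvent ends a₂ o) (connEvent ends a₁ b)) - (1 - p f) * (2 * PendantRoot.covC (Function.update p f 0) ends a₁ a₂ (connEvent ends a₂ o) (connEvent ends a₂ b) - 2 * PendantRoot.covC (Function.update p f 0) ends a₁ a₂ (connEvent ends a₂ o) (connEvent ends a₁ b)))) := by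
    refine mul_nonneg (mul_nonneg hDn hD0n) (add_nonneg (add_nonneg ?_ ?_) ?_)
    · exact mul_nonneg (mul_nonneg hDn hZ0n) (by linarith)
    · exact mul_nonneg (mul_nonneg hTn hZ0n) (by linarith)
    · exact mul_nonneg (mul_nonneg hT'n hZ0n) (by linarith)
  rw [← key] at hrhs
  have hX := (mul_nonneg_iff_of_pos_left (mul_pos hZpos hZ0pos)).1 hrhs
  linarith

/-- **The mirror along `{o, a₂}`** (root swap; the block of `a₃` is the same set). -/
theorem dChord_o_edge₂_of_separated (hp : IsProbVec p) (hf : ends f = s(o, a₂))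
    (h3 : a₃ ∉ ({a₁, a₂} : Set V)) (ho : o ∉ blk ends a₁ a₂ a₃) (hb : b ∉ blk ends a₁ a₂ a₃) :
    NMixChord (normD ends a₁ a₂ a₃) p ends o a₁ a₂ a₃ b f := by
  have h3' : a₃ ∉ ({a₂, a₁} : Set V) := by
    rwa [Set.pair_comm]
  have hblk : blk ends a₂ a₁ a₃ = blk ends a₁ a₂ a₃ := by
    unfold blk
    rw [Set.pair_comm]
  rw [← nMixChord_normD_root_swap]
  exact dChord_o_edge_of_separated p ends b hp hf h3' (hblk ▸ ho) (hblk ▸ hb)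

/-- **(HCOV) on the separated class**: `0 ≤ Gc` (`I, J, J′ ≥ 0` by the cross and same-cluster BHK). -/
theorem HCov_of_separated (hp : IsProbVec p) (h3 : a₃ ∉ ({a₁, a₂} : Set V))
    (ho : o ∉ blk ends a₁ a₂ a₃) (hb : b ∉ blk ends a₁ a₂ a₃) : HCov p ends o a₁ a₂ a₃ b := by
  unfold HCov
  have hid := Z_mul_Gc p o b h3 ho hb
  have hZn := prob_nonneg hp (avoidAll ends a₂ {a₁})
  by_cases hZ : prob p (avoidAll ends a₂ {a₁}) = 0
  · rw [Gc_eq_zero_of_Q_null hp ends o a₁ a₂ a₃ b hZ]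
  have hZpos : 0 < prob p (avoidAll ends a₂ {a₁}) := lt_of_le_of_ne hZn (Ne.symm hZ)
  have hDn := prob_nonneg hp (PDEvent ends a₁ a₂ a₃)
  have hTn := prob_nonneg hp (TEvent ends a₁ a₂ a₃)
  have hT'n := prob_nonneg hp (TEvent ends a₂ a₁ a₃)
  obtain ⟨hc1, hc2⟩ := PendantRoot.covC_cross_nonpos p ends hp o a₁ a₂ b
  have hs1 := PendantRoot.covC_same_nonneg p ends hp o a₁ a₂ b
  have hs2 := PendantRoot.covC_same_nonneg p ends hp o a₂ a₁ b
  rw [covC_root_swap p ends a₁ a₂] at hs2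
  have hI : 0 ≤ -2 * PendantRoot.covC p ends a₁ a₂ (connEvent ends a₂ o) (connEvent ends a₁ b) -
      2 * PendantRoot.covC p ends a₁ a₂ (connEvent ends a₁ o) (connEvent ends a₂ b) := by linarith
  have hJ : 0 ≤ 2 * PendantRoot.covC p ends a₁ a₂ (connEvent ends a₁ o) (connEvent ends a₁ b) -
      2 * PendantRoot.covC p ends a₁ a₂ (connEvent ends a₁ o) (connEvent ends a₂ b) := by linarith
  have hJ' : 0 ≤ 2 * PendantRoot.covC p ends a₁ a₂ (connEvent ends a₂ o) (connEvent ends a₂ b) -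
      2 * PendantRoot.covC p ends a₁ a₂ (connEvent ends a₂ o) (connEvent ends a₁ b) := by linarith
  have hrhs : 0 ≤ prob p (PDEvent ends a₁ a₂ a₃) * (prob p (PDEvent ends a₁ a₂ a₃) * (-2 * PendantRoot.covC p ends a₁ a₂ (connEvent ends a₂ o) (connEvent ends a₁ b) - 2 * PendantRoot.covC p ends a₁ a₂ (connEvent ends a₁ o) (connEvent ends a₂ b)) + prob p (TEvent ends a₁ a₂ a₃) * (2 * PendantRoot.covC p ends a₁ a₂ (connEvent ends a₁ o) (connEvent ends a₁ b) - 2 * PendantRoot.covC p ends a₁ a₂ (connEvent ends a₁ o) (connEvent ends a₂ b)) + prob p (TEvent ends a₂ a₁ a₃) * (2 * PendantRoot.covC p ends a₁ a₂ (connEvent ends a₂ o) (connEvent ends a₂ b) - 2 * PendantRoot.covC p ends a₁ a₂ (connEvent ends a₂ o) (connEvent ends a₁ b))) :=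
    mul_nonneg hDn (add_nonneg (add_nonneg (mul_nonneg hDn hI) (mul_nonneg hTn hJ)) (mul_nonneg hT'n hJ'))
  rw [← hid] at hrhs
  exact (mul_nonneg_iff_of_pos_left hZpos).1 hrhs

/-- The chain's row `(D·Z)²` along `{o, a₁}` on the separated class (unconditional: (HCOV) holds there). -/
theorem dz2Chord_o_edge_of_separated (hp : IsProbVec p) (hf : ends f = s(o, a₁))
    (h3 : a₃ ∉ ({a₁, a₂} : Set V)) (ho : o ∉ blk ends a₁ a₂ a₃) (hb : b ∉ blk ends a₁ a₂ a₃) :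
    NMixChord (normDZ2 ends a₁ a₂ a₃) p ends o a₁ a₂ a₃ b f :=
  nMixChord_DZ2_of_D hp (dChord_o_edge_of_separated p ends b hp hf h3 ho hb)
    (HCov_of_separated _ ends b (hp.update f le_rfl zero_le_one) h3 ho hb)

/-- The chain's row along `{o, a₂}` on the separated class. -/
theorem dz2Chord_o_edge₂_of_separated (hp : IsProbVec p) (hf : ends f = s(o, a₂))
    (h3 : a₃ ∉ ({a₁, a₂} : Set V)) (ho : o ∉ blk ends a₁ a₂ a₃) (hb : b ∉ blk ends a₁ a₂ a₃) :
    NMixChord (normDZ2 ends a₁ a₂ a₃) p ends o a₁ a₂ a₃ b f :=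
  nMixChord_DZ2_of_D hp (dChord_o_edge₂_of_separated p ends b hp hf h3 ho hb)
    (HCov_of_separated _ ends b (hp.update f le_rfl zero_le_one) h3 ho hb)

end Chord

end Sep

end Mix

end Summit.Ventures.PercRepro2
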